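import Summits.AnomalousDissipation.AnomalousDissipation.Theorems.DopplerClockDopplerWorkIdentity
import Mathlib.MeasureTheory.Integral.MeanInequalities

/-!
# Route DopplerClock (AnomalousDissipation) — support item `LongitudinalClassQuiet`
# (stmt-AnomalousDissipation-18134), step 2: calculus of the two streak patterns

For the swept Doppler pair `f = F sin(2πm x₁) cos(2πn x₂) e₀ = (F · Im e_M · Re e_N) e₀`
(`e_k = UnitAddTorus.mFourier k`, `M = m e₁`, `N = n e₂`) the dynamics of an `x₀`-invariant flow
is read off two pairings, with the *conjugate pattern* `Ψ_c = (Im e_M · Re e_N) e₀` and the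
*quadrature pattern* `Ψ_s = (Im e_M · Im e_N) e₀` (`DopplerWork.pattern_regular`). This file supplies
the remaining design facts:

* `copattern_regular` — `Ψ_c` is smooth, divergence free and `ΔΨ_c = −4π²(m²+n²) Ψ_c`
  (two sine Stokes modes at `M ± N`, `Im e_k Re e_l = ½ (Im e_{k+l} + Im e_{k−l})`);
* `partialDeriv_two_copattern` — `∂₂ Ψ_c = −2πn Ψ_s` (`∂ⱼ Re e_l = −2π lⱼ Im e_l`);
* `integral_inner_force_copattern` — `∫ ⟪f, Ψ_c⟫ = F/4 · (1 − [m = 0])` for `n ≠ 0`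
  (orthogonality of characters, `∫ Re e_k = [k = 0]`);
* `exists_abs_integral_inner_convect_le` — for a smooth `x₀`-independent pattern `Ψ` there is
  `K` with `|∫ ⟪w, (w·∇)Ψ⟫| ≤ K ‖w‖₂ ‖w − w₀ e₀‖₂` for every smooth `w`: the stress on an
  `x₀`-independent pattern only sees the cross-plane components of the transporting field
  (`(w·∇)Ψ = w₁ ∂₁Ψ + w₂ ∂₂Ψ`, Cauchy–Schwarz).

References: Constantin–Foias 1988, Ch. 4 (4.13)–(4.14), (4.33) (Stokes eigenfields);
Grafakos 2014, Prop. 3.2.6 (derivatives of characters). No new definitions.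
Supports stmt-AnomalousDissipation-18134.
-/

noncomputable section

-- `Summit.<Summit>.<Problem>` is the tree's mandated summit-side namespace (CONVENTIONS §2); for this
-- single-conjunct summit the two coincide, so the duplicate is deliberate.
set_option linter.dupNamespace false

open MeasureTheory Set Filter Topology
open scoped InnerProductSpace RealInnerProductSpace

namespace Summit.AnomalousDissipation.AnomalousDissipation.Theorems

open Literature.Analysis.FluidPDE Literature.Analysis.FluidPDE.Torus
open Literature.Analysis.FunctionSpaces Literature.Analysis.FunctionSpaces.Torus

namespace LongitudinalQuiet

/-! ### Character algebra -/

/-- `sin · cos` product-to-sum at the level of characters: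
`Im e_k · Re e_l = ½ (Im e_{k+l} + Im e_{k−l})`. [folklore] -/
theorem im_mul_re_mFourier (k l : Fin 3 → ℤ) (x : UnitAddTorus (Fin 3)) :
    (UnitAddTorus.mFourier k x).im * (UnitAddTorus.mFourier l x).re =
      2⁻¹ * ((UnitAddTorus.mFourier (k + l) x).im + (UnitAddTorus.mFourier (k - l) x).im) := by
  rw [sub_eq_add_neg k l, UnitAddTorus.mFourier_add, UnitAddTorus.mFourier_add,
    UnitAddTorus.mFourier_neg]
  simp only [Complex.mul_im, Complex.conj_re, Complex.conj_im]
  ring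

/-- `cos · cos` product-to-sum: `Re e_k · Re e_l = ½ (Re e_{k−l} + Re e_{k+l})`. [folklore] -/
theorem re_mul_re_mFourier (k l : Fin 3 → ℤ) (x : UnitAddTorus (Fin 3)) :
    (UnitAddTorus.mFourier k x).re * (UnitAddTorus.mFourier l x).re =
      2⁻¹ * ((UnitAddTorus.mFourier (k - l) x).re + (UnitAddTorus.mFourier (k + l) x).re) := by
  rw [sub_eq_add_neg k l, UnitAddTorus.mFourier_add, UnitAddTorus.mFourier_add,
    UnitAddTorus.mFourier_neg]
  simp only [Complex.mul_re, Complex.conj_re, Complex.conj_im]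
  ring

/-- `∫ Re e_k = [k = 0]` (`∫ e_k = δ_{k0}`). [folklore] -/
theorem integral_re_mFourier (k : Fin 3 → ℤ) :
    ∫ x : UnitAddTorus (Fin 3), (UnitAddTorus.mFourier k x).re = if k = 0 then 1 else 0 := by
  have hint : Integrable (⇑(UnitAddTorus.mFourier k)) (volume : Measure (UnitAddTorus (Fin 3))) :=
    (UnitAddTorus.mFourier k).continuous.integrable_unitAddTorus
  have h := Complex.reCLM.integral_comp_comm hint
  simp only [Complex.reCLM_apply] at h
  rw [h, integral_mFourier]
  split_ifs <;> simp

/-- `(sin)² (cos)²` as a combination of cosines: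
`(Im e_k)² (Re e_l)² = ¼ (1 + Re e_{2l} − Re e_{2k}) − ⅛ (Re e_{2k−2l} + Re e_{2k+2l})`. [folklore] -/
theorem im_sq_mul_re_sq_mFourier (k l : Fin 3 → ℤ) (x : UnitAddTorus (Fin 3)) :
    (UnitAddTorus.mFourier k x).im ^ 2 * (UnitAddTorus.mFourier l x).re ^ 2 =
      4⁻¹ * (1 + (UnitAddTorus.mFourier (l + l) x).re - (UnitAddTorus.mFourier (k + k) x).re) -
        8⁻¹ * ((UnitAddTorus.mFourier ((k + k) - (l + l)) x).re +
          (UnitAddTorus.mFourier ((k + k) + (l + l)) x).re) := by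
  have hk := DopplerWork.re_sq_add_im_sq_mFourier k x
  have hl := DopplerWork.re_sq_add_im_sq_mFourier l x
  have h1 : (UnitAddTorus.mFourier k x).im ^ 2 = 2⁻¹ * (1 - (UnitAddTorus.mFourier (k + k) x).re) := by
    have := DopplerWork.im_mul_im_mFourier k k x
    rw [sub_self, UnitAddTorus.mFourier_zero] at this
    simp only [ContinuousMap.one_apply, Complex.one_re] at this
    nlinarith [this]
  have h2 : (UnitAddTorus.mFourier l x).re ^ 2 = 2⁻¹ * (1 + (UnitAddTorus.mFourier (l + l) x).re) := by
    have := re_mul_re_mFourier l l x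
    rw [sub_self, UnitAddTorus.mFourier_zero] at this
    simp only [ContinuousMap.one_apply, Complex.one_re] at this
    nlinarith [this]
  have h3 := re_mul_re_mFourier (k + k) (l + l) x
  rw [h1, h2]
  linear_combination (-(4 : ℝ)⁻¹) * h3

/-! ### The conjugate pattern `Ψ_c = (Im e_M · Re e_N) e₀` -/

/-- `(Im e_k · Re e_l) a = ½ (stokesMode (k+l) a sin + stokesMode (k−l) a sin)`. [folklore] -/
theorem copattern_eq_stokesModes (k l : Fin 3 → ℤ) (a : EuclideanSpace ℝ (Fin 3)) :
    (fun y : UnitAddTorus (Fin 3) =>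
        ((UnitAddTorus.mFourier k y).im * (UnitAddTorus.mFourier l y).re) • a) =
      fun x => (2⁻¹ : ℝ) • (stokesMode (k + l) a false x + stokesMode (k - l) a false x) := by
  funext x
  rw [im_mul_re_mFourier, mul_smul, add_smul]
  simp [stokesMode_apply]

/-- **Regularity of the conjugate pattern**: `Ψ_c = sin(2πm x₁) cos(2πn x₂) e₀` is smooth,
divergence free and a `Δ`-eigenfield, `ΔΨ_c = −4π²(m²+n²) Ψ_c` (two sine Stokes modes at
`(0, m, ±n)`, transversal amplitude `e₀`; Constantin–Foias 1988, Ch. 4, (4.13)–(4.14), (4.33)). [folklore] -/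
theorem copattern_regular (m n : ℕ) :
    IsSmooth (fun y : UnitAddTorus (Fin 3) =>
        ((UnitAddTorus.mFourier (Pi.single (1 : Fin 3) (m : ℤ)) y).im *
          (UnitAddTorus.mFourier (Pi.single (2 : Fin 3) (n : ℤ)) y).re) •
          EuclideanSpace.single (0 : Fin 3) (1 : ℝ)) ∧
      IsDivFree (fun y : UnitAddTorus (Fin 3) =>
        ((UnitAddTorus.mFourier (Pi.single (1 : Fin 3) (m : ℤ)) y).im *
          (UnitAddTorus.mFourier (Pi.single (2 : Fin 3) (n : ℤ)) y).re) •
          EuclideanSpace.single (0 : Fin 3) (1 : ℝ)) ∧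
      ∀ x, laplacian (fun y : UnitAddTorus (Fin 3) =>
        ((UnitAddTorus.mFourier (Pi.single (1 : Fin 3) (m : ℤ)) y).im *
          (UnitAddTorus.mFourier (Pi.single (2 : Fin 3) (n : ℤ)) y).re) •
          EuclideanSpace.single (0 : Fin 3) (1 : ℝ)) x =
        -((4 * Real.pi ^ 2 * ((m : ℝ) ^ 2 + (n : ℝ) ^ 2)) •
          ((UnitAddTorus.mFourier (Pi.single (1 : Fin 3) (m : ℤ)) x).im *
            (UnitAddTorus.mFourier (Pi.single (2 : Fin 3) (n : ℤ)) x).re) •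
            EuclideanSpace.single (0 : Fin 3) (1 : ℝ)) := by
  have e₁ : stokesEigenvalue (Pi.single (1 : Fin 3) (m : ℤ) + Pi.single (2 : Fin 3) (n : ℤ)) =
      4 * Real.pi ^ 2 * ((m : ℝ) ^ 2 + (n : ℝ) ^ 2) := by
    rw [AcdcDesign.stokesEigenvalue_fin_three]
    simp
  have e₂ : stokesEigenvalue (Pi.single (1 : Fin 3) (m : ℤ) - Pi.single (2 : Fin 3) (n : ℤ)) =
      4 * Real.pi ^ 2 * ((m : ℝ) ^ 2 + (n : ℝ) ^ 2) := by
    rw [AcdcDesign.stokesEigenvalue_fin_three]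
    simp
  have t₁ : ⟪latticeVec (Pi.single (1 : Fin 3) (m : ℤ) + Pi.single (2 : Fin 3) (n : ℤ)),
      EuclideanSpace.single (0 : Fin 3) (1 : ℝ)⟫ = 0 := by
    rw [AcdcDesign.inner_latticeVec_fin_three]
    simp
  have t₂ : ⟪latticeVec (Pi.single (1 : Fin 3) (m : ℤ) - Pi.single (2 : Fin 3) (n : ℤ)),
      EuclideanSpace.single (0 : Fin 3) (1 : ℝ)⟫ = 0 := by
    rw [AcdcDesign.inner_latticeVec_fin_three]
    simp
  have hPat := copattern_eq_stokesModes (Pi.single (1 : Fin 3) (m : ℤ)) (Pi.single (2 : Fin 3) (n : ℤ))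
    (EuclideanSpace.single (0 : Fin 3) (1 : ℝ))
  rw [hPat]
  obtain ⟨hs, hΔ⟩ := AcdcDesign.eig_smul (AcdcDesign.eig_add
    (AcdcDesign.eig_mode (EuclideanSpace.single (0 : Fin 3) (1 : ℝ)) false e₁)
    (AcdcDesign.eig_mode (EuclideanSpace.single (0 : Fin 3) (1 : ℝ)) false e₂)) (2⁻¹ : ℝ)
  refine ⟨hs, ?_, fun x => ?_⟩
  · exact AcdcDesign.isDivFree_const_smul'
      ((isSmooth_stokesMode _ _ false).add (isSmooth_stokesMode _ _ false))
      (AcdcDesign.isDivFree_add' (isSmooth_stokesMode _ _ false) (isSmooth_stokesMode _ _ false)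
        (isDivFree_stokesMode t₁ false) (isDivFree_stokesMode t₂ false)) 2⁻¹
  · rw [hΔ x]
    have hx := congrFun hPat x
    rw [hx]

/-- `∂ⱼ Re e_l = −2π lⱼ Im e_l` (from `∂ⱼ e_l = 2πi lⱼ e_l`, Grafakos 2014, Prop. 3.2.6). [folklore] -/
theorem partialDeriv_re_mFourier (l : Fin 3 → ℤ) (j : Fin 3) (x : UnitAddTorus (Fin 3)) :
    partialDeriv j (fun y => (UnitAddTorus.mFourier l y).re) x =
      -(2 * Real.pi * (l j : ℝ) * (UnitAddTorus.mFourier l x).im) := by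
  have h := partialDeriv_clm_comp (isSmooth_mFourier l) Complex.reCLM j x
  rw [partialDeriv_mFourier] at h
  have e : (fun y => (UnitAddTorus.mFourier l y).re) =
      (⇑Complex.reCLM ∘ ⇑(UnitAddTorus.mFourier l)) := rfl
  rw [e, h]
  simp only [Complex.reCLM_apply, Complex.mul_re, Complex.mul_im, Complex.ofReal_re,
    Complex.ofReal_im, Complex.I_re, Complex.I_im, Complex.intCast_re, Complex.intCast_im,
    Complex.re_ofNat, Complex.im_ofNat]
  ring

/-- **The drift derivative of the conjugate pattern**: `∂₂ Ψ_c = −2πn Ψ_s`. [folklore] -/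
theorem partialDeriv_two_copattern (m n : ℕ) (x : UnitAddTorus (Fin 3)) :
    partialDeriv 2 (fun y : UnitAddTorus (Fin 3) =>
        ((UnitAddTorus.mFourier (Pi.single (1 : Fin 3) (m : ℤ)) y).im *
          (UnitAddTorus.mFourier (Pi.single (2 : Fin 3) (n : ℤ)) y).re) •
          EuclideanSpace.single (0 : Fin 3) (1 : ℝ)) x =
      (-(2 * Real.pi * n) * ((UnitAddTorus.mFourier (Pi.single (1 : Fin 3) (m : ℤ)) x).im *
          (UnitAddTorus.mFourier (Pi.single (2 : Fin 3) (n : ℤ)) x).im)) •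
        EuclideanSpace.single (0 : Fin 3) (1 : ℝ) := by
  have hM1 : IsContDiff 1 (fun y : UnitAddTorus (Fin 3) =>
      (UnitAddTorus.mFourier (Pi.single (1 : Fin 3) (m : ℤ)) y).im) :=
    (AcdcDesign.isSmooth_im_mFourier _).isContDiff (by simp)
  have hN1 : IsContDiff 1 (fun y : UnitAddTorus (Fin 3) =>
      (UnitAddTorus.mFourier (Pi.single (2 : Fin 3) (n : ℤ)) y).re) :=
    (AcdcDesign.isSmooth_re_mFourier _).isContDiff (by simp)
  have hprod : IsContDiff 1 (fun y : UnitAddTorus (Fin 3) =>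
      (UnitAddTorus.mFourier (Pi.single (1 : Fin 3) (m : ℤ)) y).im *
        (UnitAddTorus.mFourier (Pi.single (2 : Fin 3) (n : ℤ)) y).re) := ContDiff.mul hM1 hN1
  have hconst : partialDeriv 2 (fun _ : UnitAddTorus (Fin 3) => EuclideanSpace.single (0 : Fin 3) (1 : ℝ)) x = 0 := by
    simp [Torus.partialDeriv, Torus.lineDeriv]
  rw [partialDeriv_smul hprod (isContDiff_const _), hconst, smul_zero, zero_add,
    partialDeriv_mul hM1 hN1, AcdcDesign.partialDeriv_im_mFourier, partialDeriv_re_mFourier]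
  simp only [Pi.single_eq_same, Pi.single_eq_of_ne (show (2 : Fin 3) ≠ 1 by decide)]
  push_cast
  ring_nf

/-! ### The force pairing `(f, Ψ_c) = F/4` -/

/-- **The work of the force on the conjugate pattern**: for `n ≠ 0`,
`∫ ⟪f, Ψ_c⟫ = F · ¼ (1 − [m = 0])`, `f = (F · Im e_M · Re e_N) e₀`, `Ψ_c = (Im e_M · Re e_N) e₀`
(`(Im e_M)² (Re e_N)²` is `¼ (1 + Re e_{2N} − Re e_{2M}) − ⅛ (Re e_{2M−2N} + Re e_{2M+2N})` and only
the constant and, for `m = 0`, the `Re e_{2M}` term survive integration). [folklore] -/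
theorem integral_inner_force_copattern (F : ℝ) (m : ℕ) {n : ℕ} (hn : n ≠ 0) :
    ∫ x : UnitAddTorus (Fin 3),
      ⟪(F * (UnitAddTorus.mFourier (Pi.single (1 : Fin 3) (m : ℤ)) x).im *
            (UnitAddTorus.mFourier (Pi.single (2 : Fin 3) (n : ℤ)) x).re) •
          EuclideanSpace.single (0 : Fin 3) (1 : ℝ),
        ((UnitAddTorus.mFourier (Pi.single (1 : Fin 3) (m : ℤ)) x).im *
            (UnitAddTorus.mFourier (Pi.single (2 : Fin 3) (n : ℤ)) x).re) •
          EuclideanSpace.single (0 : Fin 3) (1 : ℝ)⟫ =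
      F * (4⁻¹ * (1 - if m = 0 then 1 else 0)) := by
  set M : Fin 3 → ℤ := Pi.single (1 : Fin 3) (m : ℤ) with hM
  set N : Fin 3 → ℤ := Pi.single (2 : Fin 3) (n : ℤ) with hN
  have hpt : ∀ x : UnitAddTorus (Fin 3),
      ⟪(F * (UnitAddTorus.mFourier M x).im * (UnitAddTorus.mFourier N x).re) •
          EuclideanSpace.single (0 : Fin 3) (1 : ℝ),
        ((UnitAddTorus.mFourier M x).im * (UnitAddTorus.mFourier N x).re) •
          EuclideanSpace.single (0 : Fin 3) (1 : ℝ)⟫ =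
      F * (4⁻¹ * (1 + (UnitAddTorus.mFourier (N + N) x).re - (UnitAddTorus.mFourier (M + M) x).re) -
        8⁻¹ * ((UnitAddTorus.mFourier ((M + M) - (N + N)) x).re +
          (UnitAddTorus.mFourier ((M + M) + (N + N)) x).re)) := by
    intro x
    have h0 : ⟪EuclideanSpace.single (0 : Fin 3) (1 : ℝ), EuclideanSpace.single (0 : Fin 3) (1 : ℝ)⟫ = 1 := by
      simp
    rw [real_inner_smul_left, real_inner_smul_right, h0, mul_one, ← im_sq_mul_re_sq_mFourier]
    ring
  have hc : ∀ p : Fin 3 → ℤ, Integrable (fun x : UnitAddTorus (Fin 3) => (UnitAddTorus.mFourier p x).re)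
      (volume : Measure (UnitAddTorus (Fin 3))) := fun p =>
    (Complex.continuous_re.comp (UnitAddTorus.mFourier p).continuous).integrable_unitAddTorus
  simp_rw [hpt]
  have i1 : Integrable (fun x : UnitAddTorus (Fin 3) =>
      4⁻¹ * (1 + (UnitAddTorus.mFourier (N + N) x).re - (UnitAddTorus.mFourier (M + M) x).re)) volume := by
    have j : Integrable (fun x : UnitAddTorus (Fin 3) =>
        (1 : ℝ) + (UnitAddTorus.mFourier (N + N) x).re - (UnitAddTorus.mFourier (M + M) x).re) volume :=
      ((integrable_const _).add (hc _)).sub (hc _)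
    exact j.const_mul _
  have i2 : Integrable (fun x : UnitAddTorus (Fin 3) =>
      8⁻¹ * ((UnitAddTorus.mFourier ((M + M) - (N + N)) x).re +
        (UnitAddTorus.mFourier ((M + M) + (N + N)) x).re)) volume :=
    ((hc _).add (hc _)).const_mul _
  have j1 : Integrable (fun x : UnitAddTorus (Fin 3) =>
      (1 : ℝ) + (UnitAddTorus.mFourier (N + N) x).re) volume :=
    (integrable_const _).add (hc _)
  rw [integral_const_mul, integral_sub i1 i2, integral_const_mul, integral_const_mul,
    integral_sub j1 (hc _), integral_add (integrable_const _) (hc _),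
    integral_add (hc _) (hc _), integral_re_mFourier, integral_re_mFourier, integral_re_mFourier,
    integral_re_mFourier]
  simp only [integral_const]
  -- the frequencies
  have hn' : (n : ℤ) ≠ 0 := by exact_mod_cast hn
  have hNN : N + N ≠ 0 := by
    intro h
    have := congrFun h 2
    simp [hN] at this
    omega
  have hMN1 : (M + M) - (N + N) ≠ 0 := by
    intro h
    have := congrFun h 2
    simp [hM, hN] at this
    omega
  have hMN2 : (M + M) + (N + N) ≠ 0 := by
    intro h
    have := congrFun h 2
    simp [hM, hN] at this
    omega
  have hMM : (M + M = 0) ↔ m = 0 := by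
    constructor
    · intro h
      have := congrFun h 1
      simp [hM] at this
      omega
    · intro h
      subst h
      simp [hM]
  simp only [hNN, hMN1, hMN2, if_false]
  by_cases hm : m = 0
  · rw [if_pos (hMM.2 hm), if_pos hm]
    simp
  · rw [if_neg (mt hMM.1 hm), if_neg hm]
    simp

/-! ### The fluctuation stress on an `x₀`-independent pattern -/

/-- Cauchy–Schwarz on the torus for two smooth fields: `∫ ‖a‖ ‖b‖ ≤ ‖a‖₂ ‖b‖₂`. [folklore] -/
theorem integral_norm_mul_norm_le_sqrt {a b : UnitAddTorus (Fin 3) → EuclideanSpace ℝ (Fin 3)}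
    (ha : IsSmooth a) (hb : IsSmooth b) :
    ∫ x, ‖a x‖ * ‖b x‖ ≤ Real.sqrt (∫ x, ‖a x‖ ^ 2) * Real.sqrt (∫ x, ‖b x‖ ^ 2) := by
  have hpa : MemLp a (ENNReal.ofReal 2) volume := by
    rw [ENNReal.ofReal_ofNat]
    exact ha.memLp 2
  have hpb : MemLp b (ENNReal.ofReal 2) volume := by
    rw [ENNReal.ofReal_ofNat]
    exact hb.memLp 2
  have h := integral_mul_norm_le_Lp_mul_Lq Real.HolderConjugate.two_two hpa hpb
  simp only [Real.rpow_two] at h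
  rw [Real.sqrt_eq_rpow, Real.sqrt_eq_rpow]
  exact h

/-- **The stress on an `x₀`-independent pattern only sees the cross-plane components.** For a
smooth pattern `Ψ` invariant under `x₀`-translations there is `K ≥ 0` such that for every smooth
field `w`, `|∫ ⟪w, (w·∇)Ψ⟫| ≤ K ‖w‖₂ ‖w − w₀ e₀‖₂` (`(w·∇)Ψ = w₁ ∂₁Ψ + w₂ ∂₂Ψ` since `∂₀Ψ = 0`,
`|wᵢ| ≤ ‖w − w₀ e₀‖` for `i = 1, 2`, bounded `∂ᵢΨ`, and Cauchy–Schwarz). [folklore] -/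
theorem exists_abs_integral_inner_convect_le {Ψ : UnitAddTorus (Fin 3) → EuclideanSpace ℝ (Fin 3)}
    (hΨ : IsSmooth Ψ)
    (hΨinv : ∀ (s : UnitAddCircle) (y : UnitAddTorus (Fin 3)), Ψ (y + Pi.single 0 s) = Ψ y) :
    ∃ K : ℝ, 0 ≤ K ∧ ∀ w : UnitAddTorus (Fin 3) → EuclideanSpace ℝ (Fin 3), IsSmooth w →
      |∫ x, ⟪w x, convect w Ψ x⟫| ≤
        K * Real.sqrt (∫ x, ‖w x‖ ^ 2) *
          Real.sqrt (∫ x, ‖w x - (w x 0) • EuclideanSpace.single (0 : Fin 3) (1 : ℝ)‖ ^ 2) := by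
  -- bounds for the two in-plane partial derivatives of the pattern
  obtain ⟨K₁, hK₁⟩ := isCompact_univ.exists_bound_of_continuousOn
    ((hΨ.partialDeriv 1).continuous.continuousOn (s := univ))
  obtain ⟨K₂, hK₂⟩ := isCompact_univ.exists_bound_of_continuousOn
    ((hΨ.partialDeriv 2).continuous.continuousOn (s := univ))
  set K : ℝ := |K₁| + |K₂| with hK
  have hK0 : 0 ≤ K := by positivity
  refine ⟨K, hK0, fun w hw => ?_⟩
  have hΨ1 : IsContDiff 1 Ψ := hΨ.isContDiff (by simp)
  have h0 : ∀ x, partialDeriv 0 Ψ x = 0 :=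
    GridInjection.partialDeriv_eq_zero_of_forall_add_single hΨinv
  -- pointwise bound of the stress density
  have hpt : ∀ x, ‖⟪w x, convect w Ψ x⟫‖ ≤
      K * (‖w x‖ * ‖w x - (w x 0) • EuclideanSpace.single (0 : Fin 3) (1 : ℝ)‖) := by
    intro x
    set Wx : EuclideanSpace ℝ (Fin 3) := w x - (w x 0) • EuclideanSpace.single (0 : Fin 3) (1 : ℝ)
      with hWx
    have hW1 : Wx 1 = w x 1 := by simp [hWx]
    have hW2 : Wx 2 = w x 2 := by simp [hWx]
    have hc : convect w Ψ x = (w x 1) • partialDeriv 1 Ψ x + (w x 2) • partialDeriv 2 Ψ x := by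
      rw [Torus.convect, fderiv_apply_eq_sum_partialDeriv hΨ1, Fin.sum_univ_three, h0 x, smul_zero,
        zero_add]
    have hn1 : |w x 1| ≤ ‖Wx‖ := by
      rw [← hW1, ← Real.norm_eq_abs]
      exact PiLp.norm_apply_le Wx 1
    have hn2 : |w x 2| ≤ ‖Wx‖ := by
      rw [← hW2, ← Real.norm_eq_abs]
      exact PiLp.norm_apply_le Wx 2
    have hcn : ‖convect w Ψ x‖ ≤ K * ‖Wx‖ := by
      rw [hc]
      calc ‖(w x 1) • partialDeriv 1 Ψ x + (w x 2) • partialDeriv 2 Ψ x‖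
          ≤ ‖(w x 1) • partialDeriv 1 Ψ x‖ + ‖(w x 2) • partialDeriv 2 Ψ x‖ := norm_add_le _ _
        _ = |w x 1| * ‖partialDeriv 1 Ψ x‖ + |w x 2| * ‖partialDeriv 2 Ψ x‖ := by
            rw [norm_smul, norm_smul, Real.norm_eq_abs, Real.norm_eq_abs]
        _ ≤ ‖Wx‖ * |K₁| + ‖Wx‖ * |K₂| := by
            gcongr
            · exact (hK₁ x (mem_univ x)).trans (le_abs_self _)
            · exact (hK₂ x (mem_univ x)).trans (le_abs_self _)
        _ = K * ‖Wx‖ := by rw [hK]; ring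
    calc ‖⟪w x, convect w Ψ x⟫‖ ≤ ‖w x‖ * ‖convect w Ψ x‖ := norm_inner_le_norm _ _
      _ ≤ ‖w x‖ * (K * ‖Wx‖) := mul_le_mul_of_nonneg_left hcn (norm_nonneg _)
      _ = K * (‖w x‖ * ‖Wx‖) := by ring
  -- integrate
  have hW : IsSmooth (fun x => w x - (w x 0) • EuclideanSpace.single (0 : Fin 3) (1 : ℝ)) :=
    hw.sub ((hw.apply 0).smul' (isSmooth_const _))
  have hi : Integrable (fun x => K * (‖w x‖ * ‖w x - (w x 0) • EuclideanSpace.single (0 : Fin 3) (1 : ℝ)‖))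
      volume :=
    ((hw.continuous.norm.mul hW.continuous.norm).integrable_unitAddTorus).const_mul K
  calc |∫ x, ⟪w x, convect w Ψ x⟫|
      = ‖∫ x, ⟪w x, convect w Ψ x⟫‖ := (Real.norm_eq_abs _).symm
    _ ≤ ∫ x, K * (‖w x‖ * ‖w x - (w x 0) • EuclideanSpace.single (0 : Fin 3) (1 : ℝ)‖) :=
        norm_integral_le_of_norm_le hi (ae_of_all _ hpt)
    _ = K * ∫ x, ‖w x‖ * ‖w x - (w x 0) • EuclideanSpace.single (0 : Fin 3) (1 : ℝ)‖ :=
        integral_const_mul _ _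
    _ ≤ K * (Real.sqrt (∫ x, ‖w x‖ ^ 2) *
          Real.sqrt (∫ x, ‖w x - (w x 0) • EuclideanSpace.single (0 : Fin 3) (1 : ℝ)‖ ^ 2)) :=
        mul_le_mul_of_nonneg_left (integral_norm_mul_norm_le_sqrt hw hW) hK0
    _ = _ := by ring

end LongitudinalQuiet

end Summit.AnomalousDissipation.AnomalousDissipation.Theorems

end
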